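import Literature.NumberTheory.BeurlingPrimes.BDRMultisetResidues
import Literature.Analysis.Complex.VerticalLineShiftPoles
import HarnessLib

/-!
# BDR Theorem 3.2, the Perron step with poles of higher order: the contour shift and the estimate for one pair

Topic `Literature/NumberTheory/BeurlingPrimes`, grouping namespace `BDRMultiset`. Everything in this file is PROVED.

Broucke–Debruyne–Révész (2023), proof of Theorem 3.2, (3.5)–(3.8): "`N_𝒫(x) ≤ ∫_x^{x+1} N_𝒫(u) du =
(1/2πi) ∫_{κ−i∞}^{κ+i∞} ((x+1)^{s+1} − x^{s+1})/(s(s+1)) ζ_𝒫(s) ds` (3.5) … we will shift the contour to the left …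
Applying the residue theorem, we find that the integral in (3.5) equals `a(2x+1)/2 + Σ_{ω∈𝒮_>} Res_{s=ω}(…) + (1/2πi)∫ …`
(3.7) … `E_M(s) ≪ |t|^M`, `s ∈ Γ`, `|t| ≥ 1` … the bounds following (3.4)". Here for complex multisets, with the
straight contour `Re s = σ_x = 1/2 + η_x` of the tree's `BVPerron.lean` (valid once `η_x ≤ gap/2`; all `ω ∈ 𝒮` are
then at distance `≥ η_x` from it, `BDRMultisetContZeta.dist_line_ge`), the poles crossed are `s = 1` (simple) and
the `ω ∈ 𝒮` with `Re ω > 1/2`, of order `m_ω = count ω 𝒮`; the residue theorem for poles of finite order is the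
tree's `Literature.Analysis.Complex.integral_vertical_sub_eq_sum_of_poles`.

* `PerronHypM` — the standing inputs (template data, `Z` holomorphic on `Re s > 1/2` with (3.4), `ζ_𝒫 = E_M e^Z`);
* `PerronHypM.shift` — **the contour shift**: `∫ K E e^Z(3/2+it) dt = 2π(a K(1) + Σ_{ω∈𝒮_>} Res_ω) + ∫ K E e^Z(σ_x+it) dt`
  with `Res_ω = (1/(m_ω−1)!) (d/ds)^{m_ω−1}[K(s) hOmega ω s]_{s=ω}`, and the vertical estimate with majorant
  `Eb(η_x)·B_η`;
* `res_eq_Rfun_sub` — `Res_ω = Rfun ω y₂ − Rfun ω y₁` (`Rfun ω y = y^{1+ω} Σ_i β_{ω,i}(log y)^i`,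
  `BDRMultisetResidues.lean`);
* `PerronHypM.abs_rieszCount_sub_sub_le` — **the estimate for one pair**: for `x ≥ e^{64}` with `η_x ≤ gap/2`,
  `1 ≤ y₁ ≤ y₂ ≤ y₁ + 1 ≤ x + 2`:
  `|N₁(y₂) − N₁(y₁) − a(y₂²−y₁²)/2 − Re Σ_ω (Rfun ω y₂ − Rfun ω y₁)| ≤ Eb(η_x)(768/2π) x^{1/2} e^{c L^{2/3}}`.

## References
* [BrouckeDebruyneRevesz2023] F. Broucke, G. Debruyne, Sz. Gy. Révész, *Some examples of well-behaved Beurling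
  number systems*, arXiv:2309.01567, proof of Theorem 3.2 ((3.5)–(3.8)) (read, pp. 9–10).
* [BrouckeVindas2024] F. Broucke, J. Vindas, Math. Z. 307 (2024), proof of Theorem 3.1 (tree `BVPerron.lean`).
-/

noncomputable section

open Filter Topology Complex Set MeasureTheory
open scoped ComplexConjugate Nat

namespace Literature.NumberTheory.BeurlingPrimes

open Literature.Barriers.RiemannHypothesis Literature.NumberTheory.LFunctions Literature.Analysis.Complex

namespace BDRMultiset

variable {R S : Multiset ℂ} {δ : ℝ} {M : ℕ} {Z : ℂ → ℂ} {P : BeurlingPrimes} {C : ℝ}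

/-! ### The standing inputs -/

/-- The inputs of the Perron step for Theorem 3.2 (complex multisets): `0 < Re ω, Re ρ < 1`, `0 ≤ δ < 1/2`,
`ℛ ∩ 𝒮 = ∅`; `Z` holomorphic on `Re s > 1/2` with the bound (3.4) (constant `C ≥ 0`); `ζ_𝒫 = E_M e^Z` on
`Re s > 1` and `Σ_j λ_j^{−σ} < ∞` (`σ > 1`). [cite: BrouckeDebruyneRevesz2023, proof of Theorem 3.2] -/
structure PerronHypM (R S : Multiset ℂ) (δ : ℝ) (M : ℕ) (Z : ℂ → ℂ) (P : BeurlingPrimes) (C : ℝ) : Prop where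
  hS : ∀ ω ∈ S, 0 < ω.re ∧ ω.re < 1
  hR : ∀ ρ ∈ R, 0 < ρ.re ∧ ρ.re < 1
  hδ : 0 ≤ δ
  hδ2 : δ < 1 / 2
  hRS : Disjoint R S
  hZd : DifferentiableOn ℂ Z {s : ℂ | 1 / 2 < s.re}
  hC : 0 ≤ C
  hZb : ∀ σ t : ℝ, 1 / 2 < σ →
    ‖Z (σ + t * I)‖ ≤ C * (σ / (σ - 1 / 2) + σ * Real.sqrt (Real.log (|t| + 1) / (σ - 1 / 2)))
  hzeta : ∀ s : ℂ, 1 < s.re → P.zeta s = contZ R S δ M Z s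
  hsum : ∀ σ : ℝ, 1 < σ → Summable fun j ↦ P.prime j ^ (-σ)

/-- The poles to the right of the critical line: `𝒮_> = {ω ∈ 𝒮 : Re ω > 1/2}` (as a finset). [cite: BrouckeDebruyneRevesz2023, proof of Theorem 3.2 ("𝒮_>")] -/
def polesR (S : Multiset ℂ) : Finset ℂ := S.toFinset.filter fun ω ↦ 1 / 2 < ω.re

/-- Membership in `𝒮_>`. [folklore] -/
theorem mem_polesR {ω : ℂ} : ω ∈ polesR S ↔ ω ∈ S ∧ 1 / 2 < ω.re := by
  rw [polesR, Finset.mem_filter, Multiset.mem_toFinset]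

/-- The residue of `K(s) E_M(s) e^{Z(s)}` at `ω ∈ 𝒮_>` (order `m_ω`): `(1/(m_ω−1)!) (d/ds)^{m_ω−1}[K hOmega ω]_{s=ω}`.
[cite: BrouckeDebruyneRevesz2023, proof of Theorem 3.2 (3.7)] -/
def resTerm (R S : Multiset ℂ) (δ : ℝ) (M : ℕ) (Z : ℂ → ℂ) (y₁ y₂ : ℝ) (ω : ℂ) : ℂ :=
  iteratedDeriv (S.count ω - 1) (fun s ↦ perronKernel y₁ y₂ s * hOmega R S δ M Z ω s) ω / ((S.count ω - 1)! : ℂ)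

/-! ### The residue at `ω` in terms of `Rfun` -/

/-- `K(s) · hOmega ω s = (y₂^{1+s} − y₁^{1+s}) · kOmega ω s` (identically). [folklore] -/
theorem perronKernel_mul_hOmega (y₁ y₂ : ℝ) (ω s : ℂ) :
    perronKernel y₁ y₂ s * hOmega R S δ M Z ω s =
      ((y₂ : ℂ) ^ (1 + s) - (y₁ : ℂ) ^ (1 + s)) * kOmega R S δ M Z ω s := by
  rw [perronKernel, kOmega, div_mul_eq_mul_div, mul_div_assoc]

/-- **`Res_ω = Rfun ω y₂ − Rfun ω y₁`** (`Re ω > 1/2`, `ω ≠ 1`, `y₁, y₂ > 0`). [cite: BrouckeDebruyneRevesz2023, proof of Theorem 3.2 (3.7)] -/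
theorem res_eq_Rfun_sub (hδ2 : δ < 1 / 2) (hZ : DifferentiableOn ℂ Z {s : ℂ | 1 / 2 < s.re}) {ω : ℂ}
    (hω : 1 / 2 < ω.re) (hω1 : ω ≠ 1) {y₁ y₂ : ℝ} (hy₁ : 0 < y₁) (hy₂ : 0 < y₂) :
    resTerm R S δ M Z y₁ y₂ ω = Rfun R S δ M Z ω y₂ - Rfun R S δ M Z ω y₁ := by
  set n := S.count ω - 1 with hn
  have hk : ContDiffAt ℂ n (kOmega R S δ M Z ω) ω := contDiffAt_kOmega hδ2 hZ hω hω1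
  have hf₁ : ContDiffAt ℂ n (fun s : ℂ ↦ (y₁ : ℂ) ^ (1 + s) * kOmega R S δ M Z ω s) ω :=
    (contDiff_cpow_one_add hy₁).contDiffAt.mul hk
  have hf₂ : ContDiffAt ℂ n (fun s : ℂ ↦ (y₂ : ℂ) ^ (1 + s) * kOmega R S δ M Z ω s) ω :=
    (contDiff_cpow_one_add hy₂).contDiffAt.mul hk
  have hfun : (fun s ↦ perronKernel y₁ y₂ s * hOmega R S δ M Z ω s) =
      (fun s : ℂ ↦ (y₂ : ℂ) ^ (1 + s) * kOmega R S δ M Z ω s) - fun s ↦ (y₁ : ℂ) ^ (1 + s) * kOmega R S δ M Z ω s := by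
    funext s
    simp only [Pi.sub_apply, perronKernel_mul_hOmega, sub_mul]
  rw [resTerm, Rfun, Rfun, ← hn, hfun, iteratedDeriv_sub hf₂ hf₁, sub_div]

/-! ### The threshold and the geometry of the contour -/

/-- **On the line `Re s = σ_x` with `η_x ≤ gap/2` and on `Re s = 3/2`, and in the strip at height `≥ T_𝒮`:
distance `≥ η_x` to every `ω ∈ 𝒮`** (`x ≥ e^{64}`). [cite: BrouckeDebruyneRevesz2023, proof of Theorem 3.2] -/
theorem dist_ge_eta (hS : ∀ ω ∈ S, ω.re < 1) {x : ℝ} (hx : Real.exp 64 ≤ x) (hgap : BV.eta x ≤ gapS S / 2)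
    {u t : ℝ} (hu : u = 1 / 2 + BV.eta x ∨ u = 3 / 2 ∨ TS S ≤ |t|) :
    ∀ ω ∈ S, BV.eta x ≤ ‖((u : ℂ) + t * I) - ω‖ := by
  intro ω hω
  have hη := BV.eta_pos hx
  have hη4 := BV.eta_le hx
  rcases hu with h | h | h
  · exact dist_line_ge hη hgap (s := (u : ℂ) + t * I) (by simp [h]) hω
  · exact le_trans (by linarith) (dist_right_ge hS (s := (u : ℂ) + t * I) (by simp [h]) hω)
  · exact le_trans (by linarith) (dist_strip_ge (s := (u : ℂ) + t * I) (by simpa using h) hω)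

/-- `‖(u + it) − 1‖ ≥ 1/4` when `|u − 1| ≥ 1/4` or `|t| ≥ 1`. [folklore] -/
theorem quarter_le_norm_sub_one {u t : ℝ} (h : 1 / 4 ≤ |u - 1| ∨ 1 ≤ |t|) : 1 / 4 ≤ ‖((u : ℂ) + t * I) - 1‖ := by
  rcases h with h | h
  · refine h.trans ?_
    have := Complex.abs_re_le_norm (((u : ℂ) + t * I) - 1)
    simpa using this
  · have := Complex.abs_im_le_norm (((u : ℂ) + t * I) - 1)
    simp at this; linarith

/-! ### The contour shift -/

/-- **The contour shift across the poles `1` and `ω ∈ 𝒮_>`** and the vertical estimate on `Re s = σ_x`, for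
`x ≥ e^{64}` with `η_x ≤ gap/2` and `1 ≤ y₁ ≤ y₂ ≤ y₁ + 1`:
`∫ K·E e^Z(3/2+it) dt = 2π (a K(1) + Σ_{ω∈𝒮_>} Res_ω) + ∫ K·E e^Z(σ_x+it) dt`,
`∫ ‖K·E e^Z(σ_x+it)‖ dt ≤ 4y₂^{σ_x}∫₀ˣ B/(σ_x+t) + 4y₂^{1+σ_x}∫ₓ^∞ B/t²`, `B = Eb(η_x)·B_η`.
[cite: BrouckeDebruyneRevesz2023, proof of Theorem 3.2 (3.7)–(3.8)] -/
theorem PerronHypM.shift (h : PerronHypM R S δ M Z P C) {x y₁ y₂ : ℝ} (hx : Real.exp 64 ≤ x)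
    (hgap : BV.eta x ≤ gapS S / 2) (hy₁ : 1 ≤ y₁) (hy₁₂ : y₁ ≤ y₂) (hy₂ : y₂ ≤ y₁ + 1) :
    (∫ t : ℝ, perronKernel y₁ y₂ (((3 / 2 : ℝ) : ℂ) + t * I) * contZ R S δ M Z (((3 / 2 : ℝ) : ℂ) + t * I)) =
        2 * Real.pi * (resA R S δ M Z * perronKernel y₁ y₂ ((1 : ℝ) : ℂ) +
            ∑ ω ∈ polesR S, resTerm R S δ M Z y₁ y₂ ω) +
          ∫ t : ℝ, perronKernel y₁ y₂ (((1 / 2 + BV.eta x : ℝ) : ℂ) + t * I) *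
            contZ R S δ M Z (((1 / 2 + BV.eta x : ℝ) : ℂ) + t * I) ∧
      (∫ t : ℝ, ‖perronKernel y₁ y₂ (((1 / 2 + BV.eta x : ℝ) : ℂ) + t * I) *
          contZ R S δ M Z (((1 / 2 + BV.eta x : ℝ) : ℂ) + t * I)‖) ≤
        4 * y₂ ^ (1 / 2 + BV.eta x) *
            (∫ t in Ioc 0 x, Eb R S δ M (BV.eta x) * BV.Bmaj (3 / 2 * C) (BV.eta x) t / (1 / 2 + BV.eta x + t)) +
          4 * y₂ ^ (1 + (1 / 2 + BV.eta x)) *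
            ∫ t in Ioi x, Eb R S δ M (BV.eta x) * BV.Bmaj (3 / 2 * C) (BV.eta x) t / t ^ 2 := by
  classical
  have hx0 := BV.x_pos hx
  have hη := BV.eta_pos hx
  have hη4 := BV.eta_le hx
  have hC : 0 ≤ 3 / 2 * C := by have := h.hC; positivity
  have hE0 : 0 ≤ Eb R S δ M (BV.eta x) := Eb_nonneg h.hδ h.hδ2 hη
  have hy₁0 : 0 < y₁ := by linarith
  have hy₂0 : 0 < y₂ := by linarith
  have hS1 : ∀ ω ∈ S, ω.re < 1 := fun ω hω ↦ (h.hS ω hω).2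
  have hgap1 := (gapS_pos_le (S := S)).1
  set σ₁ : ℝ := 1 / 2 + BV.eta x with hσ₁
  have hσ₁half : (1 : ℝ) / 2 < σ₁ := by rw [hσ₁]; linarith
  have hσ₁lt : σ₁ < 3 / 2 := by rw [hσ₁]; linarith
  -- the integrand, the open set, the poles
  set F : ℂ → ℂ := fun s ↦ perronKernel y₁ y₂ s * contZ R S δ M Z s with hF
  set U : Set ℂ := {s : ℂ | 1 / 2 < s.re} with hU
  have hUo : IsOpen U := isOpen_lt continuous_const Complex.continuous_re
  have hZat : ∀ {z : ℂ}, z ∈ U → DifferentiableAt ℂ Z z := fun hz ↦ h.hZd.differentiableAt (hUo.mem_nhds hz)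
  have hKat : ∀ {z : ℂ}, z ∈ U → DifferentiableAt ℂ (perronKernel y₁ y₂) z := fun hz ↦
    differentiableAt_perronKernel hy₁0 hy₂0 (lt_trans (by norm_num) hz)
  set S' : Finset ℂ := insert 1 (polesR S) with hS'
  have h1not : (1 : ℂ) ∉ polesR S := fun h1 ↦ by
    have := hS1 1 (mem_polesR.1 h1).1; simp at this
  set n : ℂ → ℕ := fun p ↦ if p = 1 then 0 else S.count p - 1 with hn
  set ψp : ℂ → ℂ → ℂ := fun p s ↦
    if p = 1 then perronKernel y₁ y₂ s * hOne R S δ M Z s else perronKernel y₁ y₂ s * hOmega R S δ M Z p s with hψp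
  -- poles strictly inside the strip
  have hpoles : ∀ p ∈ S', σ₁ < p.re ∧ p.re < 3 / 2 := by
    intro p hp
    rcases Finset.mem_insert.1 hp with rfl | hp
    · simp only [one_re]; constructor <;> linarith
    · obtain ⟨hpS, hp2⟩ := mem_polesR.1 hp
      have hg := gapS_le hpS hp2
      constructor
      · rw [hσ₁]; linarith
      · linarith [hS1 p hpS]
  -- `F` is differentiable off the poles
  have hFd : DifferentiableOn ℂ F (U \ ↑S') := by
    intro z hz
    have hzU : z ∈ U := hz.1
    have hz1 : z ≠ 1 := fun e ↦ hz.2 (by rw [e, Finset.mem_coe]; exact Finset.mem_insert_self _ _)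
    have hzS : ∀ ω ∈ S, z ≠ ω := by
      intro ω hω e
      refine hz.2 ?_
      rw [Finset.mem_coe, e]
      exact Finset.mem_insert_of_mem (mem_polesR.2 ⟨hω, by rw [← e]; exact hzU⟩)
    exact ((hKat hzU).mul (differentiableAt_contZ h.hδ2 hzU hz1 hzS (hZat hzU))).differentiableWithinAt
  -- the pole structure
  have hpole : ∀ p ∈ S', ∃ V ∈ 𝓝 p, DifferentiableOn ℂ (ψp p) V ∧
      ∀ z ∈ V, z ≠ p → F z = ψp p z / (z - p) ^ (n p + 1) := by
    intro p hp
    rcases Finset.mem_insert.1 hp with rfl | hp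
    · -- the simple pole at `1`
      set V : Set ℂ := U ∩ ⋂ ω ∈ S.toFinset, {z : ℂ | z ≠ ω} with hV
      have hVo : IsOpen V := hUo.inter (isOpen_biInter_finset fun _ _ ↦ isOpen_ne)
      have h1V : (1 : ℂ) ∈ V := by
        refine ⟨by show (1 : ℝ) / 2 < (1 : ℂ).re; norm_num, ?_⟩
        simp only [mem_iInter, mem_setOf_eq]
        intro ω hω e
        have := hS1 ω (Multiset.mem_toFinset.1 hω); rw [← e] at this; simp at this
      refine ⟨V, hVo.mem_nhds h1V, ?_, ?_⟩
      · intro z hz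
        have hzS : ∀ ω ∈ S, z ≠ ω := by
          intro ω hω
          have := hz.2; simp only [mem_iInter, mem_setOf_eq] at this
          exact this ω (Multiset.mem_toFinset.2 hω)
        simp only [hψp, if_true]
        exact ((hKat hz.1).mul (differentiableAt_hOne h.hδ2 hz.1 hzS (hZat hz.1))).differentiableWithinAt
      · intro z _ hz1
        simp only [hF, hψp, hn, if_true, zero_add, pow_one]
        rw [contZ_eq_hOne_div hz1, mul_div_assoc]
    · -- the pole of order `m_p` at `p ∈ 𝒮_>`
      obtain ⟨hpS, hp2⟩ := mem_polesR.1 hp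
      have hp1 : p ≠ 1 := fun e ↦ h1not (e ▸ hp)
      set V : Set ℂ := (U ∩ {z | z ≠ 1}) ∩ ⋂ ω' ∈ (S.toFinset.filter fun ω' ↦ ω' ≠ p), {z : ℂ | z ≠ ω'} with hV
      have hVo : IsOpen V := (hUo.inter isOpen_ne).inter (isOpen_biInter_finset fun _ _ ↦ isOpen_ne)
      have hpV : p ∈ V := by
        refine ⟨⟨hp2, hp1⟩, ?_⟩
        simp only [mem_iInter, mem_setOf_eq]
        intro ω' hω' e
        exact (Finset.mem_filter.1 hω').2 e.symm
      refine ⟨V, hVo.mem_nhds hpV, ?_, ?_⟩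
      · intro z hz
        have hzS : ∀ ω' ∈ S, ω' ≠ p → z ≠ ω' := by
          intro ω' hω' hne
          have := hz.2; simp only [mem_iInter, mem_setOf_eq] at this
          exact this ω' (Finset.mem_filter.2 ⟨Multiset.mem_toFinset.2 hω', hne⟩)
        simp only [hψp, if_neg hp1]
        exact ((hKat hz.1.1).mul (differentiableAt_hOmega h.hδ2 hz.1.1 hz.1.2 hzS (hZat hz.1.1))).differentiableWithinAt
      · intro z _ hzp
        have hm : 1 ≤ S.count p := Multiset.one_le_count_iff_mem.2 hpS
        simp only [hF, hψp, hn, if_neg hp1, Nat.sub_add_cancel hm]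
        rw [contZ_eq_hOmega_div hzp, mul_div_assoc]
  -- the majorant
  set B : ℝ → ℝ := fun t ↦ Eb R S δ M (BV.eta x) * BV.Bmaj (3 / 2 * C) (BV.eta x) t with hB
  have hB0 : 0 ≤ B 0 := mul_nonneg hE0 (BV.Bmaj_nonneg _ _ _)
  have hBm : Monotone B := fun t₁ t₂ ht ↦ mul_le_mul_of_nonneg_left (BV.Bmaj_mono hC hη ht) hE0
  have hBi : IntegrableOn (fun t ↦ B t / t ^ 2) (Ioi x) := by
    have := (BV.integrableOn_Bmaj_div_sq hC hx).const_mul (Eb R S δ M (BV.eta x))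
    refine this.congr (ae_of_all _ fun t ↦ ?_)
    simp only [hB]; ring
  have hBt : Tendsto (fun T : ℝ ↦ B T / T ^ 2) atTop (𝓝 0) := by
    have := (BV.tendsto_Bmaj_div_sq (3 / 2 * C) (BV.eta x)).const_mul (Eb R S δ M (BV.eta x))
    rw [mul_zero] at this
    refine this.congr fun T ↦ ?_
    simp only [hB]; ring
  -- the bound on `E e^Z` at admissible points of the closed strip
  have hGbound : ∀ {u : ℝ} (t : ℝ), σ₁ ≤ u → u ≤ 3 / 2 → (1 / 4 ≤ |u - 1| ∨ 1 ≤ |t|) →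
      (u = 1 / 2 + BV.eta x ∨ u = 3 / 2 ∨ TS S ≤ |t|) → ‖contZ R S δ M Z ((u : ℂ) + t * I)‖ ≤ B |t| := by
    intro u t hu1 hu2 h1 hu
    have := norm_contZ_le (R := R) (M := M) h.hδ h.hδ2 h.hC h.hZb hη (s := (u : ℂ) + t * I)
      (by simpa [hσ₁] using hu1) (by simpa using hu2) (quarter_le_norm_sub_one h1) (dist_ge_eta hS1 hx hgap hu)
    simpa [hB] using this
  have hσ₁abs : 1 / 4 ≤ |σ₁ - 1| := by rw [hσ₁, abs_of_neg (by linarith)]; linarith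
  have hκabs : 1 / 4 ≤ |(3 : ℝ) / 2 - 1| := by norm_num
  -- continuity (hence measurability) on the two lines: no poles there
  have hcont : ∀ {u : ℝ}, (u = σ₁ ∨ u = 3 / 2) → Continuous fun t : ℝ ↦ contZ R S δ M Z ((u : ℂ) + t * I) := by
    intro u hu
    have hu2 : 1 / 2 < u := by rcases hu with rfl | rfl <;> linarith
    refine continuous_iff_continuousAt.2 fun t ↦ ?_
    have hsU : ((u : ℂ) + t * I) ∈ U := by simpa [hU] using hu2
    have hs1 : ((u : ℂ) + t * I) ≠ 1 := fun e ↦ by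
      have := congrArg Complex.re e; simp at this; rcases hu with rfl | rfl <;> linarith
    have hsS : ∀ ω ∈ S, ((u : ℂ) + t * I) ≠ ω := by
      intro ω hω e
      have hu3 : u = 1 / 2 + BV.eta x ∨ u = 3 / 2 ∨ TS S ≤ |t| := by
        rcases hu with rfl | rfl
        · exact Or.inl (by rw [hσ₁])
        · exact Or.inr (Or.inl rfl)
      have hd := dist_ge_eta hS1 hx hgap hu3 ω hω
      rw [e, sub_self, norm_zero] at hd
      linarith
    exact (differentiableAt_contZ h.hδ2 hsU hs1 hsS (hZat hsU)).continuousAt.comp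
      (f := fun t : ℝ ↦ (u : ℂ) + t * I) (by fun_prop)
  -- vertical estimates (integrability + bound) on both lines
  have hV₁ := perron_vertical_norm_le (G := contZ R S δ M Z) (B := B) (σ := σ₁) (lt_trans (by norm_num) hσ₁half)
    hy₁0 hy₁₂ hy₂ hx0 (hcont (Or.inl rfl)).aestronglyMeasurable
    (fun t ↦ hGbound t le_rfl hσ₁lt.le (Or.inl hσ₁abs) (Or.inl (by rw [hσ₁]))) hB0 hBm hBi
  have hVκ := perron_vertical_norm_le (G := contZ R S δ M Z) (B := B) (σ := (3 / 2 : ℝ)) (by norm_num)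
    hy₁0 hy₁₂ hy₂ hx0 (hcont (Or.inr rfl)).aestronglyMeasurable
    (fun t ↦ hGbound t hσ₁lt.le le_rfl (Or.inl hκabs) (Or.inr (Or.inl rfl))) hB0 hBm hBi
  -- horizontal decay in the strip
  have hy₂1 : 1 ≤ y₂ := hy₁.trans hy₁₂
  have hdecay0 : ∀ T : ℝ, max (TS S) 1 ≤ |T| → ∀ u ∈ Icc σ₁ (3 / 2 : ℝ),
      ‖F ((u : ℂ) + T * I)‖ ≤ 2 * y₂ ^ (1 + (3 / 2 : ℝ)) * (B |T| / |T| ^ 2) := by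
    intro T hT u hu
    have hT1 : 1 ≤ |T| := le_trans (le_max_right _ _) hT
    have hTS : TS S ≤ |T| := le_trans (le_max_left _ _) hT
    have hu0 : 0 < u := lt_trans (by norm_num) (lt_of_lt_of_le hσ₁half hu.1)
    have hGb := hGbound T hu.1 hu.2 (Or.inr hT1) (Or.inr (Or.inr hTS))
    have hBT : 0 ≤ B |T| := le_trans (norm_nonneg _) hGb
    have hK := norm_perronKernel_le_two_mul hy₁0 hy₁₂ hu0 T
    have hden : |T| ^ 2 ≤ ‖((u : ℂ) + T * I) * ((u : ℂ) + T * I + 1)‖ := by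
      rw [sq_abs]; exact sq_le_norm_kernelDen hu0.le T
    have hT2 : 0 < |T| ^ 2 := by positivity
    have hpow : y₂ ^ (1 + u) ≤ y₂ ^ (1 + (3 / 2 : ℝ)) := Real.rpow_le_rpow_of_exponent_le hy₂1 (by linarith [hu.2])
    have hK' : ‖perronKernel y₁ y₂ ((u : ℂ) + T * I)‖ ≤ 2 * y₂ ^ (1 + (3 / 2 : ℝ)) / |T| ^ 2 := by
      refine hK.trans ?_
      calc 2 * y₂ ^ (1 + u) / ‖((u : ℂ) + T * I) * ((u : ℂ) + T * I + 1)‖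
          ≤ 2 * y₂ ^ (1 + u) / |T| ^ 2 := div_le_div_of_nonneg_left (by positivity) hT2 hden
        _ ≤ 2 * y₂ ^ (1 + (3 / 2 : ℝ)) / |T| ^ 2 := by gcongr
    simp only [hF, norm_mul]
    calc ‖perronKernel y₁ y₂ ((u : ℂ) + T * I)‖ * ‖contZ R S δ M Z ((u : ℂ) + T * I)‖
        ≤ 2 * y₂ ^ (1 + (3 / 2 : ℝ)) / |T| ^ 2 * B |T| := mul_le_mul hK' hGb (norm_nonneg _) (by positivity)
      _ = 2 * y₂ ^ (1 + (3 / 2 : ℝ)) * (B |T| / |T| ^ 2) := by ring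
  have hg : Tendsto (fun T : ℝ ↦ 2 * y₂ ^ (1 + (3 / 2 : ℝ)) * (B T / T ^ 2)) atTop (𝓝 0) := by
    simpa using hBt.const_mul (2 * y₂ ^ (1 + (3 / 2 : ℝ)))
  have hdecay := decay_of_bound (F := F) (σ₁ := σ₁) (κ := (3 / 2 : ℝ)) hdecay0 hg
  -- the residue theorem for poles of finite order
  have hUS : re ⁻¹' Icc σ₁ (3 / 2 : ℝ) ⊆ U := fun z hz ↦ lt_of_lt_of_le hσ₁half hz.1
  have hres := integral_vertical_sub_eq_sum_of_poles (F := F) hσ₁lt S' n ψp U hUo hUS hpoles hFd hpole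
    hVκ.1 hV₁.1 hdecay
  -- evaluate the residue sum
  have hsum : ∑ p ∈ S', iteratedDeriv (n p) (ψp p) p / ((n p)! : ℂ) =
      resA R S δ M Z * perronKernel y₁ y₂ ((1 : ℝ) : ℂ) + ∑ ω ∈ polesR S, resTerm R S δ M Z y₁ y₂ ω := by
    rw [hS', Finset.sum_insert h1not]
    congr 1
    · simp only [hn, hψp, if_true, iteratedDeriv_zero, Nat.factorial_zero, Nat.cast_one, div_one, resA]
      push_cast; ring
    · refine Finset.sum_congr rfl fun ω hω ↦ ?_
      have hω1 : ω ≠ 1 := fun e ↦ h1not (e ▸ hω)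
      simp only [hn, hψp, if_neg hω1, resTerm]
  refine ⟨?_, hV₁.2⟩
  have := hres
  rw [hsum] at this
  simp only [hF] at this
  linear_combination this

/-! ### The Perron identity on `Re s = 3/2` and the estimate for one pair -/

/-- On the line `Re s = 3/2`: `N₁(y₂) − N₁(y₁) = (1/2π) ∫ K(y₁,y₂; 3/2+it) E e^Z(3/2+it) dt`.
[cite: BrouckeDebruyneRevesz2023, proof of Theorem 3.2 (3.5)–(3.6)] -/
theorem PerronHypM.rieszCount_sub_eq (h : PerronHypM R S δ M Z P C) {y₁ y₂ : ℝ} (hy₁ : 0 < y₁) (hy₂ : 0 < y₂) :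
    ((P.rieszCount y₂ - P.rieszCount y₁ : ℝ) : ℂ) =
      (1 / (2 * Real.pi) : ℂ) * ∫ t : ℝ, perronKernel y₁ y₂ (((3 / 2 : ℝ) : ℂ) + t * I) *
        contZ R S δ M Z (((3 / 2 : ℝ) : ℂ) + t * I) := by
  rw [P.rieszCount_sub_eq_integral hy₁ hy₂ (by norm_num : (1:ℝ) < 3 / 2) (h.hsum _ (by norm_num))]
  congr 1
  refine integral_congr_ae (Eventually.of_forall fun t ↦ ?_)
  have hs : 1 < (((3 / 2 : ℝ) : ℂ) + t * I).re := by simp; norm_num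
  show ((y₂ : ℂ) ^ (1 + (((3 / 2 : ℝ) : ℂ) + t * I)) - (y₁ : ℂ) ^ (1 + (((3 / 2 : ℝ) : ℂ) + t * I))) *
      P.zeta (((3 / 2 : ℝ) : ℂ) + t * I) * (1 / ((((3 / 2 : ℝ) : ℂ) + t * I) * ((((3 / 2 : ℝ) : ℂ) + t * I) + 1))) =
      perronKernel y₁ y₂ (((3 / 2 : ℝ) : ℂ) + t * I) * contZ R S δ M Z (((3 / 2 : ℝ) : ℂ) + t * I)
  rw [h.hzeta _ hs, perronKernel]
  ring

/-- **The Perron estimate for one pair `(y₁, y₂)`**: for `x ≥ e^{64}` with `η_x ≤ gap/2`, `1 ≤ y₁ ≤ y₂ ≤ y₁ + 1`,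
`y₂ ≤ x + 1`: `|N₁(y₂) − N₁(y₁) − a(y₂² − y₁²)/2 − Re Σ_{ω∈𝒮_>} (Rfun ω y₂ − Rfun ω y₁)| ≤
Eb(η_x)(768/2π) x^{1/2} e^{c L^{2/3}}` (`a = Re resA`, `c = cexpo(3C/2)`). [cite: BrouckeDebruyneRevesz2023, proof of Theorem 3.2 (3.7)–(3.8)] -/
theorem PerronHypM.abs_rieszCount_sub_sub_le (h : PerronHypM R S δ M Z P C) {x y₁ y₂ : ℝ} (hx : Real.exp 64 ≤ x)
    (hgap : BV.eta x ≤ gapS S / 2) (hy₁ : 1 ≤ y₁) (hy₁₂ : y₁ ≤ y₂) (hy₂ : y₂ ≤ y₁ + 1) (hy₂x : y₂ ≤ x + 1) :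
    |P.rieszCount y₂ - P.rieszCount y₁ - (resA R S δ M Z).re * ((y₂ ^ 2 - y₁ ^ 2) / 2) -
        (∑ ω ∈ polesR S, (Rfun R S δ M Z ω y₂ - Rfun R S δ M Z ω y₁)).re| ≤
      Eb R S δ M (BV.eta x) * (768 / (2 * Real.pi)) *
        (x ^ (1 / 2 : ℝ) * Real.exp (BV.cexpo (3 / 2 * C) * Real.log x ^ (2 / 3 : ℝ))) := by
  have hy₁0 : 0 < y₁ := by linarith
  have hy₂0 : 0 < y₂ := by linarith
  have hη := BV.eta_pos hx
  have hC : 0 ≤ 3 / 2 * C := by have := h.hC; positivity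
  have hE0 : 0 ≤ Eb R S δ M (BV.eta x) := Eb_nonneg h.hδ h.hδ2 hη
  have hS1 : ∀ ω ∈ S, ω.re < 1 := fun ω hω ↦ (h.hS ω hω).2
  have hR1 : ∀ ρ ∈ R, ρ.re < 1 := fun ρ hρ ↦ (h.hR ρ hρ).2
  obtain ⟨hshift, hvert⟩ := h.shift hx hgap hy₁ hy₁₂ hy₂
  set Iσ : ℂ := ∫ t : ℝ, perronKernel y₁ y₂ (((1 / 2 + BV.eta x : ℝ) : ℂ) + t * I) *
    contZ R S δ M Z (((1 / 2 + BV.eta x : ℝ) : ℂ) + t * I) with hIσ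
  set Mt : ℂ := resA R S δ M Z * perronKernel y₁ y₂ ((1 : ℝ) : ℂ) + ∑ ω ∈ polesR S, resTerm R S δ M Z y₁ y₂ ω with hMt
  -- the identity `ΔN₁ = Mt + Iσ/(2π)`
  have hid : ((P.rieszCount y₂ - P.rieszCount y₁ : ℝ) : ℂ) = Mt + (1 / (2 * Real.pi) : ℂ) * Iσ := by
    rw [h.rieszCount_sub_eq hy₁0 hy₂0, hshift, mul_add]
    congr 1
    have hπ : (Real.pi : ℂ) ≠ 0 := by exact_mod_cast Real.pi_pos.ne'
    field_simp
  -- real parts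
  have hZ1 : DifferentiableAt ℂ Z 1 :=
    h.hZd.differentiableAt ((isOpen_lt continuous_const Complex.continuous_re).mem_nhds (by norm_num))
  have hMre : Mt.re = (resA R S δ M Z).re * ((y₂ ^ 2 - y₁ ^ 2) / 2) +
      (∑ ω ∈ polesR S, (Rfun R S δ M Z ω y₂ - Rfun R S δ M Z ω y₁)).re := by
    rw [hMt, add_re]
    congr 1
    · rw [resA_eq_ofReal h.hδ2 hS1 hR1 h.hzeta hZ1, BV.perronKernel_one]
      rw [← Complex.ofReal_mul, Complex.ofReal_re, Complex.ofReal_re]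
    · congr 1
      refine Finset.sum_congr rfl fun ω hω ↦ ?_
      obtain ⟨hωS, hω2⟩ := mem_polesR.1 hω
      have hω1 : ω ≠ 1 := fun e ↦ by have := hS1 ω hωS; rw [e] at this; simp at this
      exact res_eq_Rfun_sub h.hδ2 h.hZd hω2 hω1 hy₁0 hy₂0
  have hre : P.rieszCount y₂ - P.rieszCount y₁ = Mt.re + 1 / (2 * Real.pi) * Iσ.re := by
    have := congrArg Complex.re hid
    rw [ofReal_re, add_re] at this
    rw [this]
    congr 1
    have h1 : (1 / (2 * Real.pi) : ℂ) = ((1 / (2 * Real.pi) : ℝ) : ℂ) := by push_cast; ring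
    rw [h1, Complex.re_ofReal_mul]
  -- the estimate of the shifted integral
  have hI : ‖Iσ‖ ≤ Eb R S δ M (BV.eta x) * (768 * (x ^ (1 / 2 : ℝ) *
      Real.exp (BV.cexpo (3 / 2 * C) * Real.log x ^ (2 / 3 : ℝ)))) := by
    refine (MeasureTheory.norm_integral_le_integral_norm _).trans (hvert.trans ?_)
    have h1 := BV.first_piece_le hC hx hy₂0 hy₂x
    have h2 := BV.second_piece_le hC hx hy₂0 hy₂x
    have e1 : ∫ t in Ioc 0 x, Eb R S δ M (BV.eta x) * BV.Bmaj (3 / 2 * C) (BV.eta x) t / (1 / 2 + BV.eta x + t) =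
        Eb R S δ M (BV.eta x) * ∫ t in Ioc 0 x, BV.Bmaj (3 / 2 * C) (BV.eta x) t / (1 / 2 + BV.eta x + t) := by
      rw [← MeasureTheory.integral_const_mul]
      exact integral_congr_ae (Eventually.of_forall fun t ↦ by ring)
    have e2 : ∫ t in Ioi x, Eb R S δ M (BV.eta x) * BV.Bmaj (3 / 2 * C) (BV.eta x) t / t ^ 2 =
        Eb R S δ M (BV.eta x) * ∫ t in Ioi x, BV.Bmaj (3 / 2 * C) (BV.eta x) t / t ^ 2 := by
      rw [← MeasureTheory.integral_const_mul]
      exact integral_congr_ae (Eventually.of_forall fun t ↦ by ring)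
    rw [e1, e2]
    have hy₂pow : 0 ≤ 4 * y₂ ^ (1 / 2 + BV.eta x) := by positivity
    have hy₂pow' : 0 ≤ 4 * y₂ ^ (1 + (1 / 2 + BV.eta x)) := by positivity
    nlinarith [mul_le_mul_of_nonneg_left h1 hE0, mul_le_mul_of_nonneg_left h2 hE0]
  have hsub : P.rieszCount y₂ - P.rieszCount y₁ - (resA R S δ M Z).re * ((y₂ ^ 2 - y₁ ^ 2) / 2) -
      (∑ ω ∈ polesR S, (Rfun R S δ M Z ω y₂ - Rfun R S δ M Z ω y₁)).re = 1 / (2 * Real.pi) * Iσ.re := by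
    rw [hre, hMre]; ring
  rw [hsub, abs_mul, abs_of_pos (by positivity : 0 < 1 / (2 * Real.pi))]
  calc 1 / (2 * Real.pi) * |Iσ.re| ≤ 1 / (2 * Real.pi) * (Eb R S δ M (BV.eta x) * (768 * (x ^ (1 / 2 : ℝ) *
        Real.exp (BV.cexpo (3 / 2 * C) * Real.log x ^ (2 / 3 : ℝ))))) :=
        mul_le_mul_of_nonneg_left ((Complex.abs_re_le_norm _).trans hI) (by positivity)
    _ = Eb R S δ M (BV.eta x) * (768 / (2 * Real.pi)) *
        (x ^ (1 / 2 : ℝ) * Real.exp (BV.cexpo (3 / 2 * C) * Real.log x ^ (2 / 3 : ℝ))) := by ring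

end BDRMultiset

end Literature.NumberTheory.BeurlingPrimes
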